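import Summits.CriticalPhenomena.PercolationContinuityZ3.Theses.PercMinContact
import Summits.CriticalPhenomena.PercolationContinuityZ3.Theorems.PercMinContactTwoArmGlue
import Literature.Probability.Percolation.TwoGhostInequalityProofs
import Literature.Probability.Percolation.SharpnessDCTProofs
import HarnessLib

/-!
# Line `root_tail_split` for crux `SwallowTail` — item stmt-CriticalPhenomena-11497,
# route `PercMinContact` (rank 2), sub-problem `PercolationContinuityZ3` (crux-strategist, 2026-08-17)

Crux BY NAME: `Summit.CriticalPhenomena.PercolationContinuityZ3.Theses.PercMinContact.SwallowTail`
`= ∃ p < p_c(ℤ³), ∫_{(p,p_c)} m(u) du < ⊤`, where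
`m(u) = E_u[Σ_{y ∼ 0} 1{0 ↮ y} min(|C(0)|, |C(y)|)]` is the MIN-CONTACT FUNCTION of bond percolation on `ℤ³`
at level `projIcc u` (cluster sizes in `ℕ∞`, expectation in `[0, ∞]`).

## The cut: LEVEL-INTEGRATED ROOT-TAIL SPLIT at `(q, r) = (11/20, 1/2)`

Layer cake (LANDED, `Theorems.lintegral_sum_indicator_min_le`): `m(u) ≤ Σ_{n ≥ 1} T_n(u)`,
`T_n(u) := Σ_{y ∼ 0} P_u(|C(0)| ≥ n, |C(y)| ≥ n, 0 ↮ y)` (adjacent-distinct volume two-arm function).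
Write `P_n(u) := P_u(|C(0)| ≥ n)`.

* `stub_rootTailTwoArm` (A, two-cluster, p-UNIFORM): `T_n(u) ≤ C · n^{-11/20} · P_n(u)^{1/2}` for all
  `0 ≤ u < p_c`, `n ≥ 1`.  The RIGOROUS frontier in this `(q, r)`-currency is `(1/2, 1/2)` up to a geometric
  smoothing of the tail: Hutchcroft's two-ghost argument (arXiv:2008.11197 §3, Lemma 3.3 + Lemma 3.4 + the dyadic
  Cauchy–Schwarz in the proof of Lemma 3.5, run WITHOUT the power-law hypothesis) gives
  `T_n ≤ C n^{-1/2} Σ_{j ≥ 0} e^{-j/2} P_{⌈n e^{-j}⌉}(u)^{1/2}` uniformly in `u`; the printed corollary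
  (arXiv:1808.08940 Cor. 1.7, PROVED in the tree: `Hutchcroft2020_twoGhost_corollary_holds`) is its `P ≤ 1` shadow
  `T_n ≤ C n^{-1/2}`.  Stub A asks for `n^{-1/20}` MORE on the two-cluster side.  Scaling: `T_n(p_c) ≍ n^{-λ₂}`,
  `λ₂ = (d − 1/ν)/d_f ≈ 0.737` (pivotal hyperscaling; refuter MC on the crux item: `0.74–0.81`), against the claim
  `n^{-(11/20 + 1/(2δ))} = n^{-0.645}`: margin `0.09–0.17`.  Consistent in `d = 2` (`60/91 ≥ 0.578`) and mean field
  (`1 ≥ 0.8`).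
* `stub_integratedRootTail` (B, ONE-cluster, LEVEL-INTEGRATED): `∃ p₀ < p_c, ∫_{(p₀,p_c)} Σ_n n^{-11/20} P_n(u)^{1/2} du < ∞`.
  Scaling at `u = p_c − ε`: `Σ_{n ≲ ε^{-Δ}} n^{-11/20 − 1/(2δ)} ≍ ε^{-Δ(1 − 0.645)} = ε^{-0.79}`, integrable (margin 0.21);
  it also holds WITHOUT the in-window tail whenever the gap exponent is `< 20/9 = 2.22` (truth `Δ ≈ 2.21`).
  NOT costume: the in-tree certificate that killed `MinContactExponent/Lines/birth` (Hutchcroft 2022 Thm 1.3 +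
  Markov; `Theorems.percolationContinuityZ3_of_halfMomentExponent`) yields, from `∫ R_q < ∞` with
  `R_q(u) = Σ_n n^{-q} P_n(u)^{r}`, only `θ(p_c) ≲ (ε R_q(p_c−ε))^{1/r} ε^{(2(1−q)−1)/r}`, which tends to `0` iff
  `q ≤ 1/2`; for `q = 11/20` the exponent is `−1/5 < 0` (no conclusion).  Jump-world reading: in a `θ(p_c) > 0` world
  the same KL inequality forces `P_{p_c−ε}(|C| ≥ n) ≥ θ/4` for `n ≤ c θ ε^{-2}`, hence `R_q(p_c−ε) ≳ ε^{-2(1−q)} = ε^{-0.9}`,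
  still integrable — B kills only jump worlds whose near-critical window exponent exceeds `20/9`, and is therefore
  strictly sub-summit.  A POINTWISE variant `R_q(u) ≤ C ε^{-a₀}` is, on the contrary, costume whenever it carries the
  true exponent `a₀ = Δ(1−q−r/δ)`, as soon as `(Δ−2)(1−q) < rβ` — always for plain moments (`r = 1`, because
  `Δ − 2 ≈ 0.21 < β ≈ 0.42`) and here (`0.21·0.45 < 0.42/2`): the level integral is essential.

Composition `SwallowTail_of` (real proof, no `sorry`): with `p := max p₀ 0 < p_c` (`p_c > 0`, Grimmett 1999 §1.4,
PROVED), for `u ∈ (p, p_c)`: `m(u) ≤ Σ_n T_n(u) ≤ Σ_n C·n^{-q} P_n^{1/2} = C Σ_n …` (layer cake ▸ A termwise ▸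
`ENNReal.tsum_mul_left`), then `setLIntegral_mono'` ▸ `lintegral_const_mul'` ▸ monotonicity in the domain ▸ B.

## Costume / shredding check
Two stubs, both ≥ L.  A is a RATIO-type two-cluster bound (holds at level `0` with `C ≥ 6`; silent about `θ(p_c)`:
jump-compatible); B never mentions two clusters; neither implies the crux (A needs a one-cluster partner, B a
two-cluster one) nor the summit (certificate above).  Probes `stub → SwallowTail`, `stub → PercolationContinuityZ3`
by `first | exact? | simpa | aesop` fail 4/4 (planner folder `bc/SwallowTail_probes.lean`).

## Relation to the other lines of the route
* `MinContactExponent/Lines/birth` (DEAD, costume): `(q, r) = (1/2, 1)` with a POINTWISE half-moment partner.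
  Here `q` is moved across `1/2` (partner non-costume), `r` lowered to `1/2` (A within `1/20` of the two-ghost
  frontier), and the partner is LEVEL-INTEGRATED (removes the `a₀ ∈ [2−2q, 1)` sliver of `birth-dead.md`).
* `TwoArmWindow/Lines/birth` (LIVE, lead c2): `(q, r) = (3/5, 0)` with a SUP-window partner `Δ₀ < 5/2`.  Different
  allocation and different currencies on both sides; neither line's stubs imply the other's.

## Disproof used
No `Cruxes/SwallowTail/Disproof.lean`, no `Theorems/SwallowTail/Negative/*` (2026-08-17, `ledger crux ls`);
`ledger negatives --problem CriticalPhenomena` (11 items): nothing on moments / two-arm events / min-contact.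
Refuter evidence on the item honoured: `PercMinContactNumerics.md` (m(p_c−s) ≈ C s^{-0.6}; λ ≈ 0.74–0.81) and the
level-0 corner (m(0) = 6: stub A needs `C ≥ 6`, allowed).
-/

noncomputable section

namespace Summit.CriticalPhenomena.PercolationContinuityZ3.Cruxes.SwallowTail.RootTailSplit

open MeasureTheory
open scoped ENNReal BigOperators
open Literature.Probability.Percolation Literature.Probability.LatticeModels
open Summit.CriticalPhenomena.PercolationContinuityZ3.Theses.PercMinContact

/-! ## Objects (abbreviations used by the composition; the stub signatures below are self-contained) -/

/-- The min-contact function `m(u)` at real level `u` (the crux's integrand, verbatim). -/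
def minContact (u : ℝ) : ℝ≥0∞ :=
  ∫⁻ ω, ∑ y ∈ (zdGraph 3).neighborFinset (0 : Site 3),
      (openConn (0 : Site 3) y)ᶜ.indicator
        (fun ω => min ((openCluster ω 0).encard : ℝ≥0∞) ((openCluster ω y).encard : ℝ≥0∞)) ω
    ∂(bondPercolation (zdGraph 3) (Set.projIcc (0 : ℝ) 1 zero_le_one u))

/-- The adjacent-distinct volume two-arm function `T_{k+1}(u) = Σ_{y ∼ 0} P_u(|C(0)| ≥ k+1, |C(y)| ≥ k+1, 0 ↮ y)`. -/
def twoArm (u : ℝ) (k : ℕ) : ℝ≥0∞ :=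
  ∑ y ∈ (zdGraph 3).neighborFinset (0 : Site 3),
    bondPercolation (zdGraph 3) (Set.projIcc (0 : ℝ) 1 zero_le_one u)
      {ω | ((k + 1 : ℕ) : ℕ∞) ≤ (openCluster ω (0 : Site 3)).encard ∧
        ((k + 1 : ℕ) : ℕ∞) ≤ (openCluster ω y).encard ∧ ¬ (openGraph ω).Reachable 0 y}

/-- The root-tail term `(k+1)^{-11/20} · P_u(|C(0)| ≥ k+1)^{1/2}`. -/
def rootTail (u : ℝ) (k : ℕ) : ℝ≥0∞ :=
  ENNReal.ofReal (((k + 1 : ℕ) : ℝ) ^ (-(11 / 20 : ℝ))) *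
    (bondPercolation (zdGraph 3) (Set.projIcc (0 : ℝ) 1 zero_le_one u) (clusterSizeGe (0 : Site 3) (k + 1))) ^
      (1 / 2 : ℝ)

/-! ## The stubs (signatures self-contained over `Literature.Probability.Percolation`) -/

/-- **Stub A — ROOT-TAIL TWO-ARM BOUND at `(q, r) = (11/20, 1/2)` (two-cluster, p-uniform; open; size XL).**
There is `C` such that for every level `0 ≤ u < p_c(ℤ³)` and every `n = k+1 ≥ 1`,
`Σ_{y ∼ 0} P_u(|C(0)| ≥ n, |C(y)| ≥ n, 0 ↮ y) ≤ C · n^{-11/20} · P_u(|C(0)| ≥ n)^{1/2}`.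
Rigorous frontier: `(q, r) = (1/2, 1/2)` with a geometrically smoothed tail (Hutchcroft, arXiv:2008.11197 §3,
Lemmas 3.3–3.5 without the power-law step); printed shadow `T_n ≤ 66·2d·√((1−u)/(u n))` (arXiv:1808.08940 Cor. 1.7,
PROVED in the tree).  Why plausibly true: `λ₂ ≈ 0.737 ≥ 0.55 + 1/(2δ) ≈ 0.645` (margin `0.09`; MC `0.74–0.81`);
true in `d = 2` (`60/91 ≥ 0.578`) and in mean field (`1 ≥ 0.8`).  Why it might fail: every published improvement of
the two-ghost exponent `1/2` consumes an a-priori critical volume tail (summit-strength); `λ₂` is a hyperscaling value.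
Leans on: `TwoGhostInequalityProofs` (`TwoGhost.lintegral_sq_hp_le`, `TwoGhost.edge_vertex_mass_transport`,
`Hutchcroft2020_twoGhost_corollary_holds`), `DCT16.perc_sharpness_holds`, BK.
[cite: Hutchcroft2021, Theorem 3.1 and Lemmas 3.3–3.5 (improved two-ghost inequality)] -/
theorem stub_rootTailTwoArm :
    ∃ C : ℝ, ∀ u : ℝ, 0 ≤ u → u < criticalProb (zdGraph 3) (0 : Site 3) → ∀ k : ℕ,
      ∑ y ∈ (zdGraph 3).neighborFinset (0 : Site 3),
          bondPercolation (zdGraph 3) (Set.projIcc (0 : ℝ) 1 zero_le_one u)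
            {ω | ((k + 1 : ℕ) : ℕ∞) ≤ (openCluster ω (0 : Site 3)).encard ∧
              ((k + 1 : ℕ) : ℕ∞) ≤ (openCluster ω y).encard ∧ ¬ (openGraph ω).Reachable 0 y}
        ≤ ENNReal.ofReal C *
            (ENNReal.ofReal (((k + 1 : ℕ) : ℝ) ^ (-(11 / 20 : ℝ))) *
              (bondPercolation (zdGraph 3) (Set.projIcc (0 : ℝ) 1 zero_le_one u)
                (clusterSizeGe (0 : Site 3) (k + 1))) ^ (1 / 2 : ℝ)) := by
  sorry

/-- **Stub B — LEVEL-INTEGRATED ROOT-TAIL MOMENT (one-cluster; open; size L–XL).** There is `p₀ < p_c(ℤ³)` with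
`∫_{(p₀, p_c)} Σ_{n ≥ 1} n^{-11/20} P_u(|C(0)| ≥ n)^{1/2} du < ∞` (level `projIcc u`).
Why plausibly true: scaling `≍ ∫ ε^{-Δ(1 − 11/20 − 1/(2δ))} dε = ∫ ε^{-0.79} dε < ∞` (margin `0.21`); holds without
the in-window tail when the gap exponent is `< 20/9`.  Why it might fail: an UPPER bound on a divergent subcritical
functional in `d = 3`, where only `γ ≥ 1` and `ξ ≤ exp(C/ε²)` are rigorous; false in `d = 2` under scaling
(`Δ = 91/36`), so a proof must use `d = 3`.  NOT summit-strength: the Hutchcroft–Markov certificate gives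
`θ(p_c) ≲ (εR)² ε^{-1/5}` only (see header).  Leans on: `DCT16.perc_sharpness_holds` (finiteness at each `u < p_c`),
monotone coupling `configOfLabels` (monotonicity in `u`), `Hutchcroft2022_thm13_holds` (KL across levels),
`russo_formula_holds`.
[cite: Hutchcroft2020, Theorem 1.2 (Δ ≤ γ + 1: the only rigorous volume-window mechanism, conditional on a χ bound)] -/
theorem stub_integratedRootTail :
    ∃ p₀ : ℝ, p₀ < criticalProb (zdGraph 3) (0 : Site 3) ∧
      ∫⁻ u in Set.Ioo p₀ (criticalProb (zdGraph 3) (0 : Site 3)),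
          (∑' k : ℕ, ENNReal.ofReal (((k + 1 : ℕ) : ℝ) ^ (-(11 / 20 : ℝ))) *
            (bondPercolation (zdGraph 3) (Set.projIcc (0 : ℝ) 1 zero_le_one u)
              (clusterSizeGe (0 : Site 3) (k + 1))) ^ (1 / 2 : ℝ)) < ⊤ := by
  sorry

/-! ## Name-keyed aliases (hypotheses of the composition, keyed by the registered stub names) -/
namespace Registered

/-- Alias of the statement of `stub_rootTailTwoArm`. -/
abbrev stub_rootTailTwoArm : Prop :=
  ∃ C : ℝ, ∀ u : ℝ, 0 ≤ u → u < criticalProb (zdGraph 3) (0 : Site 3) → ∀ k : ℕ,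
    ∑ y ∈ (zdGraph 3).neighborFinset (0 : Site 3),
        bondPercolation (zdGraph 3) (Set.projIcc (0 : ℝ) 1 zero_le_one u)
          {ω | ((k + 1 : ℕ) : ℕ∞) ≤ (openCluster ω (0 : Site 3)).encard ∧
            ((k + 1 : ℕ) : ℕ∞) ≤ (openCluster ω y).encard ∧ ¬ (openGraph ω).Reachable 0 y}
      ≤ ENNReal.ofReal C *
          (ENNReal.ofReal (((k + 1 : ℕ) : ℝ) ^ (-(11 / 20 : ℝ))) *
            (bondPercolation (zdGraph 3) (Set.projIcc (0 : ℝ) 1 zero_le_one u)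
              (clusterSizeGe (0 : Site 3) (k + 1))) ^ (1 / 2 : ℝ))

/-- Alias of the statement of `stub_integratedRootTail`. -/
abbrev stub_integratedRootTail : Prop :=
  ∃ p₀ : ℝ, p₀ < criticalProb (zdGraph 3) (0 : Site 3) ∧
    ∫⁻ u in Set.Ioo p₀ (criticalProb (zdGraph 3) (0 : Site 3)),
        (∑' k : ℕ, ENNReal.ofReal (((k + 1 : ℕ) : ℝ) ^ (-(11 / 20 : ℝ))) *
          (bondPercolation (zdGraph 3) (Set.projIcc (0 : ℝ) 1 zero_le_one u)
            (clusterSizeGe (0 : Site 3) (k + 1))) ^ (1 / 2 : ℝ)) < ⊤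

end Registered

/-- Consistency: each alias IS the registered stub's statement (definitionally). -/
theorem rootTailTwoArm_holds : Registered.stub_rootTailTwoArm := stub_rootTailTwoArm

/-- Consistency: each alias IS the registered stub's statement (definitionally). -/
theorem integratedRootTail_holds : Registered.stub_integratedRootTail := stub_integratedRootTail

/-! ## Composition: the stubs conclude the crux BY NAME (real proof, no `sorry`) -/

/-- Pointwise step: for `0 ≤ u < p_c`, stub A and the landed layer cake give
`m(u) ≤ ofReal (max C 0) · Σ_k rootTail u k`. -/
theorem minContact_le_of_A {C : ℝ}
    (hA : ∀ u : ℝ, 0 ≤ u → u < criticalProb (zdGraph 3) (0 : Site 3) → ∀ k : ℕ,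
      twoArm u k ≤ ENNReal.ofReal C * rootTail u k)
    {u : ℝ} (hu0 : 0 ≤ u) (hupc : u < criticalProb (zdGraph 3) (0 : Site 3)) :
    minContact u ≤ ENNReal.ofReal (max C 0) * ∑' k : ℕ, rootTail u k := by
  -- Step 1: layer cake in `ℕ∞` + Tonelli (landed with item TwoArmGlue).
  have h1 : minContact u ≤ ∑' k : ℕ, twoArm u k :=
    Summit.CriticalPhenomena.PercolationContinuityZ3.Theorems.lintegral_sum_indicator_min_le
      (zdGraph 3) (Set.projIcc (0 : ℝ) 1 zero_le_one u) (0 : Site 3) ((zdGraph 3).neighborFinset (0 : Site 3))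
  -- Step 2: stub A term by term, then pull the constant out of the series.
  have h2 : ∑' k : ℕ, twoArm u k ≤ ∑' k : ℕ, ENNReal.ofReal C * rootTail u k :=
    ENNReal.tsum_le_tsum fun k => hA u hu0 hupc k
  have h3 : ∑' k : ℕ, ENNReal.ofReal C * rootTail u k ≤ ENNReal.ofReal (max C 0) * ∑' k : ℕ, rootTail u k := by
    rw [ENNReal.tsum_mul_left]
    exact mul_le_mul' (ENNReal.ofReal_le_ofReal (le_max_left C 0)) le_rfl
  exact h1.trans (h2.trans h3)

/-- **The skeleton theorem.** The root-tail two-arm bound (stub A) and the level-integrated root-tail moment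
(stub B) give `SwallowTail` with `p := max p₀ 0`:
`∫_{(p,p_c)} m ≤ ofReal (max C 0) · ∫_{(p,p_c)} Σ_k rootTail ≤ ofReal (max C 0) · ∫_{(p₀,p_c)} Σ_k rootTail < ⊤`. -/
theorem SwallowTail_of (hA : Registered.stub_rootTailTwoArm) (hB : Registered.stub_integratedRootTail) :
    Summit.CriticalPhenomena.PercolationContinuityZ3.Theses.PercMinContact.SwallowTail := by
  obtain ⟨C, hA⟩ := hA
  obtain ⟨p₀, hp₀, hB⟩ := hB
  have hpc : 0 < criticalProb (zdGraph 3) (0 : Site 3) :=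
    (Grimmett1999_criticalProb_pos_lt_one_holds 3 (by norm_num)).1
  refine ⟨max p₀ 0, max_lt hp₀ hpc, ?_⟩
  -- pointwise bound on the integration range
  have hpt : ∀ u ∈ Set.Ioo (max p₀ 0) (criticalProb (zdGraph 3) (0 : Site 3)),
      minContact u ≤ ENNReal.ofReal (max C 0) * ∑' k : ℕ, rootTail u k := by
    intro u hu
    exact minContact_le_of_A hA ((le_max_right p₀ 0).trans hu.1.le) hu.2
  have hfin : ENNReal.ofReal (max C 0) *
      ∫⁻ u in Set.Ioo p₀ (criticalProb (zdGraph 3) (0 : Site 3)), ∑' k : ℕ, rootTail u k < ⊤ :=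
    ENNReal.mul_lt_top ENNReal.ofReal_lt_top hB
  calc ∫⁻ u in Set.Ioo (max p₀ 0) (criticalProb (zdGraph 3) (0 : Site 3)), minContact u
      ≤ ∫⁻ u in Set.Ioo (max p₀ 0) (criticalProb (zdGraph 3) (0 : Site 3)),
          ENNReal.ofReal (max C 0) * ∑' k : ℕ, rootTail u k :=
        setLIntegral_mono' measurableSet_Ioo hpt
    _ = ENNReal.ofReal (max C 0) *
          ∫⁻ u in Set.Ioo (max p₀ 0) (criticalProb (zdGraph 3) (0 : Site 3)), ∑' k : ℕ, rootTail u k :=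
        lintegral_const_mul' _ _ ENNReal.ofReal_ne_top
    _ ≤ ENNReal.ofReal (max C 0) *
          ∫⁻ u in Set.Ioo p₀ (criticalProb (zdGraph 3) (0 : Site 3)), ∑' k : ℕ, rootTail u k :=
        mul_le_mul' le_rfl (lintegral_mono_set (Set.Ioo_subset_Ioo_left (le_max_left p₀ 0)))
    _ < ⊤ := hfin

/-- Wiring check: the two registered stubs feed `SwallowTail_of` as stated. -/
example : Summit.CriticalPhenomena.PercolationContinuityZ3.Theses.PercMinContact.SwallowTail :=
  SwallowTail_of rootTailTwoArm_holds integratedRootTail_holds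

/-! ## Sorry-free dividends: where the stubs sit -/

/-- **Printed shadow of stub A, by name**: the UNCONDITIONAL two-ghost inequality (Hutchcroft 2020, Cor. 1.7) is a
theorem of the tree. [cite: Hutchcroft2020Locality, Corollary 1.7] -/
theorem twoGhost_frontier : Hutchcroft2020_twoGhost_corollary :=
  Hutchcroft2020_twoGhost_corollary_holds

/-- **Far-regime input of both stubs, by name**: sharpness of the phase transition on `ℤ^d`.
[cite: AizenmanBarsky1987, Theorem 1 (sharpness; tree proof via Duminil-Copin–Tassion)] -/
theorem sharpness_frontier : perc_sharpness :=
  DCT16.perc_sharpness_holds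

end Summit.CriticalPhenomena.PercolationContinuityZ3.Cruxes.SwallowTail.RootTailSplit

end
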